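/-
Copyright: the b2b-balaban T⁴-continuum CRUX team, row NE7b leaf lineage `t4-ne7b-formalise-leaf-01` (gen 83). Project licence.
-/
import Mathlib.Analysis.SpecialFunctions.Trigonometric.Deriv
import Mathlib.Analysis.SpecialFunctions.Exp
import Mathlib.Analysis.Calculus.IteratedDeriv.Lemmas
import Mathlib.Analysis.Calculus.ContDiff.Operations
import Mathlib.Topology.Algebra.InfiniteSum.NatInt
import Mathlib.Topology.Algebra.InfiniteSum.Order
import Summits.QuantumFields.BalabanUV.T4Continuum.Spine.NE7b.InheritedHessianPowerCounting

/-!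
# THE MOMENTUM-SMOOTHNESS LETTER IS LOCALITY: for a finitely supported kernel `k` with real frequencies `ω` (a lattice kernel
# on `ℤ`: `ω x = x`; on `ℤᵈ` along a ray of direction `e`: `ω x = Σ_j x_j e_j`) the symbol `Φ(t) = Σ_{i∈s} k(i)·cos(ω_i·t)` is even,
# `Φ(0) = Σ_i k(i)` (so the position-space Ward identity «`k` annihilates constants» IS «no mass term»), `Φ″(0) = −Σ_i k(i)ω_i²`
# (the marginal coefficient is minus the second moment), `|Φ⁽ⁿ⁾| ≤ Σ_i |k(i)|·|ω_i|ⁿ` (the `n`-th derivative letter IS the `n`-th absolute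
# moment), a decay `|k(x)| ≤ M e^{−κ|x|}` on `ℤ` makes every moment `≤ M·Σ'_{m∈ℤ} |m|ⁿe^{−κ|m|}`, and the subtracted symbol obeys
# `|Φ(t) + ½(Σ_i k(i)ω_i²)t²| ≤ (Σ_i |k(i)|ω_i⁴∕6)·t⁴` (row NE7b, node U5c; kernel lemmas of calculus)

Cell `pub-balaban`, sub-cell `t4`, spine estimate NE7b (`T4WeightBudget.RelWeightBound`; the cell's OWN estimate — NOT PRINTED in
[Bałaban 1983–89], NOT PROVED).  Crux-route work under `Spine/NE7b/` by a row leaf on the windowed convexity road (R-P1); NOTHING of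
Bałaban's is named as a Lean object, valued or asserted; no `T4Continuum/Support` leaf typed; no `def`; zero `sorry`.  Imports: Mathlib +
the sibling `…InheritedHessianPowerCounting` (leaf-01 g83) for the junction §4.

WHY.  `…InheritedHessianPowerCounting` (IHPC) types the refuter's R-AHL-g83-1 (c) in shape and DISPLAYS, per inherited kernel `Φ` read
as a function of MOMENTUM, four letters: (W) no constant term, (R) evenness, (S) the quadratic part a multiple of the main form, and
(D) a fourth-derivative letter `‖D⁴Φ‖ ≤ K₄`.  This file says WHERE (W), (R), (D) come from for the simplest honest model of an inherited
term — a translation-invariant quadratic form on a lattice with a finitely supported position-space kernel `k`, whose Hessian on the plane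
wave of momentum `p = t·e` is the symbol `Φ(t) = Σ_x k(x)cos(t·⟨x, e⟩)`: (R) is automatic; (W) `Φ(0) = 0` is EXACTLY `Σ_x k(x) = 0`, i.e. the
kernel annihilates constant fields (the position-space face of the Ward identity ∕ of «no mass term»); and (D) is LOCALITY —
`|Φ⁗| ≤ Σ_x |k(x)|·⟨x, e⟩⁴`, a fourth absolute (directional) moment, finite and `≤ M·C₄(κ)` under a decay `|k(x)| ≤ Me^{−κ|x|}` (print's tree
decay `E₀e^{−κd_j(X)}` read BY SHAPE; a field-space Cauchy letter sizes `M`, it does not supply (D) — leaf-01 g83 A-1 l.57161).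

WHAT IS PROVED ([folklore]; Mathlib's `Real.iteratedDeriv_even_cos` ∕ `_odd_cos`, `iteratedDeriv_comp_const_mul`,
`iteratedFDeriv_sum_apply`, `Real.summable_pow_mul_exp_neg_nat_mul`, `Summable.sum_le_tsum` BY NAME; throughout `s : Finset ι`,
weights `k : ι → ℝ`, frequencies `ω : ι → ℝ`, the symbol written inline as `fun t => Σ i ∈ s, k i * cos (ω i * t)`):
* §1 THE SYMBOL: `symbol_neg` (even), `symbol_zero` (`Φ 0 = Σ_i k i`), `symbol_zero_eq_zero` (`Σ_i k i = 0 ⟹ Φ 0 = 0`),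
  `sum_mul_const_eq_zero_iff` (the kernel annihilates a non-zero constant field iff `Σ_i k i = 0`), `contDiff_symbol`.
* §2 DERIVATIVES ARE MOMENTS: `abs_iteratedDeriv_cos_le_one`, `iteratedDeriv_cos_mul` (`(cos(a·))⁽ⁿ⁾(t) = aⁿ cos⁽ⁿ⁾(at)`),
  `iteratedDeriv_symbol` (termwise), **`abs_iteratedDeriv_symbol_le`** (`|Φ⁽ⁿ⁾(t)| ≤ Σ_i |k i|·|ω i|ⁿ` for EVERY `n`, `t`),
  `iteratedDeriv_two_symbol_zero` (`Φ″(0) = −Σ_i k i·(ω i)²`).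
* §3 DECAY GIVES THE MOMENTS (`ι = ℤ`, `ω x = x`): `summable_abs_pow_mul_exp_neg_abs` (`Σ_{m∈ℤ} |m|ⁿe^{−κ|m|} < ∞`, `κ > 0`),
  **`moment_le_of_decay`** (`|k x| ≤ Me^{−κ|x|}` on `s` ⟹ `Σ_{x∈s} |k x|·|x|ⁿ ≤ M·Σ'_{m∈ℤ} |m|ⁿe^{−κ|m|}`).
* §4 JUNCTION WITH IHPC §4 BY NAME: **`abs_symbol_sub_marginal_le`** (`Σ_i k i = 0` ⟹ for every `t`,
  `|Φ(t) + ½(Σ_i k i·(ω i)²)t²| ≤ (Σ_i |k i|·|ω i|⁴)∕6 · t⁴` — `…norm_sub_half_hessian_le_of_iteratedFDeriv_four_le` with `E = G = ℝ`,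
  its `K₄` = the fourth moment, its `½·D²Φ(0)[t,t]` = `−½(Σ k ω²)t²`), and on `ℤ` **`abs_symbol_sub_marginal_le_of_decay`** (the same
  with `K₄ ≤ M·C₄(κ)`).
* §5 RAYS IN `ℤᵈ`: `symbol_ray` — the `d`-dimensional symbol `Σ_x k x·cos(Σ_j x_j p_j)` at `p = t•e` IS the one-variable symbol with
  the directional frequencies `ω x = Σ_j x_j e_j`; **`abs_symbol_ray_sub_marginal_le`** — the junction along every ray, with the fourth
  directional moment `Σ_x |k x|·(Σ_j x_j e_j)⁴`.
* §6 toy: the lattice Laplacian kernel `k(0) = −2, k(±1) = 1` annihilates constants and has symbol `2cos t − 2` (`laplacian_symbol`).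

NOT HERE (honest): infinite support (a `tsum` symbol; dominated differentiation), operator- or form-valued kernels (polarisation indices),
the bound of directional moments by isotropic ones (`|⟨x,e⟩| ≤ ‖x‖·‖e‖`, left to the consumer's norm), WHICH kernels print's inherited terms
have and their `(M, κ)` ([B12] (1.18) read BY SHAPE only), the marginal part's split into «multiple of the main form + anisotropic
remainder» (IHPC §6 absorbs only the former).  BY-NAME EFFECT ON THE WALL: NONE (a supplier for IHPC's displayed letters (W), (R), (D)).
NE7b NOT PRINTED ∕ NOT PROVED; spine PROVED 0∕9; rung (B)+1 on a FINITE torus — NOT infinite volume, NOT the mass gap, NOT Clay.  HONEST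
DEPENDENCY: continuum YM on T⁴ ⇐ BetaPertH ∧ nine spine estimates (0∕9 proved); BetaPertH ⇐ (D1) ∧ (D4) ∧ CAP+tail; G-an2-4 gates asym,
D1 and NE2∕3∕4.
-/

namespace Summit.QuantumFields.BalabanUV.T4Continuum.NE7b.LatticeKernelMoments

open Real Finset

noncomputable section

variable {ι : Type*} {s : Finset ι} {k ω : ι → ℝ}

/-! ## §1 The symbol of a finitely supported kernel with real frequencies -/

/-- **EVEN** (letter (R) is automatic for a real symmetric quadratic form): `Φ(−t) = Φ(t)`. [folklore] -/
theorem symbol_neg (s : Finset ι) (k ω : ι → ℝ) (t : ℝ) :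
    (∑ i ∈ s, k i * cos (ω i * -t)) = ∑ i ∈ s, k i * cos (ω i * t) := by
  simp [mul_neg, cos_neg]

/-- **AT ZERO MOMENTUM THE SYMBOL IS THE TOTAL MASS OF THE KERNEL**: `Φ(0) = Σ_i k i`. [folklore] -/
theorem symbol_zero (s : Finset ι) (k ω : ι → ℝ) : (∑ i ∈ s, k i * cos (ω i * (0 : ℝ))) = ∑ i ∈ s, k i := by
  simp

/-- **THE POSITION-SPACE WARD IDENTITY IS «NO MASS TERM»** (letter (W)): `Σ_i k i = 0 ⟹ Φ(0) = 0`. [folklore] -/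
theorem symbol_zero_eq_zero (ω : ι → ℝ) (hW : ∑ i ∈ s, k i = 0) : (∑ i ∈ s, k i * cos (ω i * (0 : ℝ))) = 0 := by
  rw [symbol_zero, hW]

/-- The kernel annihilates a non-zero constant field `c` (`Σ_i k(i)·c = 0`) iff its total mass vanishes. [folklore] -/
theorem sum_mul_const_eq_zero_iff {c : ℝ} (hc : c ≠ 0) : (∑ i ∈ s, k i * c) = 0 ↔ ∑ i ∈ s, k i = 0 := by
  rw [← Finset.sum_mul, mul_eq_zero, or_iff_left hc]

/-- The symbol is smooth (a finite sum of cosines). [folklore] -/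
theorem contDiff_symbol (s : Finset ι) (k ω : ι → ℝ) {n : WithTop ℕ∞} :
    ContDiff ℝ n fun t : ℝ => ∑ i ∈ s, k i * cos (ω i * t) :=
  ContDiff.sum fun _ _ => contDiff_const.mul (contDiff_cos.comp (contDiff_const.mul contDiff_id))

/-! ## §2 Derivatives of the symbol are moments of the kernel -/

/-- Every derivative of `cos` is bounded by `1`. [folklore] -/
theorem abs_iteratedDeriv_cos_le_one (n : ℕ) (y : ℝ) : |iteratedDeriv n cos y| ≤ 1 := by
  rcases Nat.even_or_odd' n with ⟨m, rfl | rfl⟩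
  · rw [Real.iteratedDeriv_even_cos]
    simp only [Pi.mul_apply, Pi.pow_apply, Pi.neg_apply, Pi.one_apply, abs_mul, abs_pow, abs_neg, abs_one,
      one_pow, one_mul]
    exact abs_cos_le_one _
  · rw [Real.iteratedDeriv_odd_cos]
    simp only [Pi.mul_apply, Pi.pow_apply, Pi.neg_apply, Pi.one_apply, abs_mul, abs_pow, abs_neg, abs_one,
      one_pow, one_mul]
    exact abs_sin_le_one _

/-- `(t ↦ cos(a·t))⁽ⁿ⁾(t) = aⁿ·cos⁽ⁿ⁾(a·t)` (Mathlib's `iteratedDeriv_comp_const_mul`). [folklore] -/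
theorem iteratedDeriv_cos_mul (a : ℝ) (n : ℕ) (t : ℝ) :
    iteratedDeriv n (fun q : ℝ => cos (a * q)) t = a ^ n * iteratedDeriv n cos (a * t) := by
  rw [iteratedDeriv_comp_const_mul contDiff_cos a]

/-- **TERMWISE**: `Φ⁽ⁿ⁾(t) = Σ_i k i·((ω i)ⁿ·cos⁽ⁿ⁾(ω i·t))`. [folklore] -/
theorem iteratedDeriv_symbol (s : Finset ι) (k ω : ι → ℝ) (n : ℕ) (t : ℝ) :
    iteratedDeriv n (fun q : ℝ => ∑ i ∈ s, k i * cos (ω i * q)) t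
      = ∑ i ∈ s, k i * (ω i ^ n * iteratedDeriv n cos (ω i * t)) := by
  have hcos : ∀ i : ι, ContDiff ℝ n (fun q : ℝ => cos (ω i * q)) := fun i =>
    contDiff_cos.comp (contDiff_const.mul contDiff_id)
  have hterm : ∀ i ∈ s, ContDiffAt ℝ n (fun q : ℝ => k i * cos (ω i * q)) t := fun i _ =>
    (contDiff_const.mul (hcos i)).contDiffAt
  rw [iteratedDeriv_eq_iteratedFDeriv, iteratedFDeriv_fun_sum_apply hterm, _root_.sum_apply]
  refine Finset.sum_congr rfl fun i _ => ?_
  rw [← iteratedDeriv_eq_iteratedFDeriv, iteratedDeriv_const_mul (k i) (hcos i).contDiffAt, iteratedDeriv_cos_mul]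

/-- **THE `n`-TH DERIVATIVE LETTER IS THE `n`-TH ABSOLUTE MOMENT** (letter (D) at `n = 4`): for every `n` and every `t`,
`|Φ⁽ⁿ⁾(t)| ≤ Σ_i |k i|·|ω i|ⁿ`. [folklore] -/
theorem abs_iteratedDeriv_symbol_le (s : Finset ι) (k ω : ι → ℝ) (n : ℕ) (t : ℝ) :
    |iteratedDeriv n (fun q : ℝ => ∑ i ∈ s, k i * cos (ω i * q)) t| ≤ ∑ i ∈ s, |k i| * |ω i| ^ n := by
  rw [iteratedDeriv_symbol]
  refine (Finset.abs_sum_le_sum_abs _ _).trans (Finset.sum_le_sum fun i _ => ?_)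
  rw [abs_mul, abs_mul, abs_pow]
  refine mul_le_mul_of_nonneg_left ?_ (abs_nonneg _)
  calc |ω i| ^ n * |iteratedDeriv n cos (ω i * t)| ≤ |ω i| ^ n * 1 := by
        gcongr; exact abs_iteratedDeriv_cos_le_one n _
    _ = |ω i| ^ n := mul_one _

/-- **THE MARGINAL COEFFICIENT IS MINUS THE SECOND MOMENT**: `Φ″(0) = −Σ_i k i·(ω i)²`. [folklore] -/
theorem iteratedDeriv_two_symbol_zero (s : Finset ι) (k ω : ι → ℝ) :
    iteratedDeriv 2 (fun q : ℝ => ∑ i ∈ s, k i * cos (ω i * q)) 0 = -∑ i ∈ s, k i * ω i ^ 2 := by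
  rw [iteratedDeriv_symbol, ← Finset.sum_neg_distrib]
  refine Finset.sum_congr rfl fun i _ => ?_
  rw [show (2 : ℕ) = 2 * 1 by norm_num, Real.iteratedDeriv_even_cos]
  simp

/-! ## §3 Decay gives the moments (`ι = ℤ`, `ω x = x`) -/

/-- `Σ_{m∈ℤ} |m|ⁿ e^{−κ|m|}` converges for `κ > 0` (both tails are Mathlib's `Real.summable_pow_mul_exp_neg_nat_mul`). [folklore] -/
theorem summable_abs_pow_mul_exp_neg_abs (n : ℕ) {κ : ℝ} (hκ : 0 < κ) :
    Summable fun m : ℤ => |(m : ℝ)| ^ n * exp (-κ * |(m : ℝ)|) := by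
  rw [summable_int_iff_summable_nat_and_neg]
  constructor
  · simpa using summable_pow_mul_exp_neg_nat_mul n hκ
  · simpa using summable_pow_mul_exp_neg_nat_mul n hκ

/-- **DECAY GIVES THE MOMENTS** [folklore]: `|k x| ≤ M e^{−κ|x|}` on the support (`κ > 0`, `M ≥ 0`) ⟹
`Σ_{x∈s} |k x|·|x|ⁿ ≤ M·Σ'_{m∈ℤ} |m|ⁿe^{−κ|m|}` — the (D) letter of IHPC is a decay constant times a universal number. -/
theorem moment_le_of_decay {s : Finset ℤ} {k : ℤ → ℝ} (n : ℕ) {κ M : ℝ} (hκ : 0 < κ) (hM : 0 ≤ M)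
    (hdecay : ∀ x ∈ s, |k x| ≤ M * exp (-κ * |(x : ℝ)|)) :
    ∑ x ∈ s, |k x| * |(x : ℝ)| ^ n ≤ M * ∑' m : ℤ, |(m : ℝ)| ^ n * exp (-κ * |(m : ℝ)|) := by
  calc ∑ x ∈ s, |k x| * |(x : ℝ)| ^ n ≤ ∑ x ∈ s, M * (|(x : ℝ)| ^ n * exp (-κ * |(x : ℝ)|)) :=
        Finset.sum_le_sum fun x hx => by
          calc |k x| * |(x : ℝ)| ^ n ≤ M * exp (-κ * |(x : ℝ)|) * |(x : ℝ)| ^ n := by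
                gcongr; exact hdecay x hx
            _ = M * (|(x : ℝ)| ^ n * exp (-κ * |(x : ℝ)|)) := by ring
    _ = M * ∑ x ∈ s, |(x : ℝ)| ^ n * exp (-κ * |(x : ℝ)|) := by rw [Finset.mul_sum]
    _ ≤ M * ∑' m : ℤ, |(m : ℝ)| ^ n * exp (-κ * |(m : ℝ)|) := by
        gcongr
        exact (summable_abs_pow_mul_exp_neg_abs n hκ).sum_le_tsum s fun m _ => by positivity

/-! ## §4 Junction with `…InheritedHessianPowerCounting` §4 by name -/

/-- **THE SUBTRACTED SYMBOL IS BOUNDED BY THE FOURTH MOMENT** [folklore]: if the kernel annihilates constants (`Σ_i k i = 0`, letter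
(W)), then for EVERY `t`, `|Φ(t) + ½(Σ_i k i·(ω i)²)·t²| ≤ (Σ_i |k i|·|ω i|⁴)∕6 · t⁴` — IHPC's
`norm_sub_half_hessian_le_of_iteratedFDeriv_four_le` with `E = G = ℝ`, evenness from §1, `K₄` = the fourth absolute moment from §2,
and `½·D²Φ(0)[t,t] = −½(Σ_i (ω i)²k i)t²` from `iteratedDeriv_two_symbol_zero`. -/
theorem abs_symbol_sub_marginal_le (ω : ι → ℝ) (hW : ∑ i ∈ s, k i = 0) (t : ℝ) :
    |(∑ i ∈ s, k i * cos (ω i * t)) + 1 / 2 * (∑ i ∈ s, k i * ω i ^ 2) * t ^ 2|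
      ≤ (∑ i ∈ s, |k i| * |ω i| ^ 4) / 6 * t ^ 4 := by
  have h := InheritedHessianPowerCounting.norm_sub_half_hessian_le_of_iteratedFDeriv_four_le
    (Φ := fun q : ℝ => ∑ i ∈ s, k i * cos (ω i * q)) (K₄ := ∑ i ∈ s, |k i| * |ω i| ^ 4) (ρ := ‖t‖)
    (contDiff_symbol s k ω) (fun q => symbol_neg s k ω q) (symbol_zero_eq_zero ω hW)
    (fun q _ => by rw [norm_iteratedFDeriv_eq_norm_iteratedDeriv, Real.norm_eq_abs]; exact abs_iteratedDeriv_symbol_le s k ω 4 q)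
    (le_refl ‖t‖)
  rw [iteratedFDeriv_apply_eq_iteratedDeriv_mul_prod, iteratedDeriv_two_symbol_zero, Real.norm_eq_abs, Real.norm_eq_abs,
    Finset.prod_const, Finset.card_univ, Fintype.card_fin, smul_eq_mul, smul_eq_mul] at h
  have e : (∑ i ∈ s, k i * cos (ω i * t)) - 1 / 2 * (t ^ 2 * -∑ i ∈ s, k i * ω i ^ 2)
      = (∑ i ∈ s, k i * cos (ω i * t)) + 1 / 2 * (∑ i ∈ s, k i * ω i ^ 2) * t ^ 2 := by ring
  rw [e] at h
  calc _ ≤ (∑ i ∈ s, |k i| * |ω i| ^ 4) / 6 * |t| ^ 4 := h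
    _ = (∑ i ∈ s, |k i| * |ω i| ^ 4) / 6 * t ^ 4 := by
        rw [show |t| ^ 4 = t ^ 4 from by rw [show (4 : ℕ) = 2 * 2 by norm_num, pow_mul, sq_abs, ← pow_mul]]

/-- **… AND BY THE DECAY CONSTANTS ON `ℤ`** [folklore]: with `|k x| ≤ Me^{−κ|x|}` on the support,
`|Φ(t) + ½(Σ_x k x·x²)t²| ≤ M·(Σ'_{m∈ℤ} m⁴e^{−κ|m|})∕6 · t⁴` for every `t`. -/
theorem abs_symbol_sub_marginal_le_of_decay {s : Finset ℤ} {k : ℤ → ℝ} (hW : ∑ x ∈ s, k x = 0) {κ M : ℝ} (hκ : 0 < κ)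
    (hM : 0 ≤ M) (hdecay : ∀ x ∈ s, |k x| ≤ M * exp (-κ * |(x : ℝ)|)) (t : ℝ) :
    |(∑ x ∈ s, k x * cos (x * t)) + 1 / 2 * (∑ x ∈ s, k x * (x : ℝ) ^ 2) * t ^ 2|
      ≤ M * (∑' m : ℤ, |(m : ℝ)| ^ 4 * exp (-κ * |(m : ℝ)|)) / 6 * t ^ 4 := by
  refine (abs_symbol_sub_marginal_le (fun x : ℤ => (x : ℝ)) hW t).trans ?_
  have ht : 0 ≤ t ^ 4 := by positivity
  gcongr
  exact moment_le_of_decay 4 hκ hM hdecay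

/-! ## §5 Rays in `ℤᵈ`: the `d`-dimensional symbol along `p = t•e` is a one-variable symbol with directional frequencies -/

/-- **RAYS**: `Σ_x k x·cos(Σ_j x_j·(t·e_j)) = Σ_x k x·cos((Σ_j x_j e_j)·t)` — the `d`-dimensional symbol read along the ray `p = t•e` is the
one-variable symbol with the directional frequencies `ω x = Σ_j x_j e_j`. [folklore] -/
theorem symbol_ray {d : ℕ} (s : Finset (Fin d → ℤ)) (k : (Fin d → ℤ) → ℝ) (e : Fin d → ℝ) (t : ℝ) :
    (∑ x ∈ s, k x * cos (∑ j, (x j : ℝ) * (t * e j))) = ∑ x ∈ s, k x * cos ((∑ j, (x j : ℝ) * e j) * t) := by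
  refine Finset.sum_congr rfl fun x _ => ?_
  rw [Finset.sum_mul]
  congr 2
  exact Finset.sum_congr rfl fun j _ => by ring

/-- **THE JUNCTION ALONG EVERY RAY IN `ℤᵈ`** [folklore]: a finitely supported kernel on `ℤᵈ` annihilating constants (`Σ_x k x = 0`) has,
along every direction `e` and for every `t`,
`|Σ_x k x·cos(Σ_j x_j·t e_j) + ½(Σ_x k x·⟨x,e⟩²)t²| ≤ (Σ_x |k x|·⟨x,e⟩⁴)∕6 · t⁴` — the fourth DIRECTIONAL moment is the (D) letter. -/
theorem abs_symbol_ray_sub_marginal_le {d : ℕ} {s : Finset (Fin d → ℤ)} {k : (Fin d → ℤ) → ℝ}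
    (hW : ∑ x ∈ s, k x = 0) (e : Fin d → ℝ) (t : ℝ) :
    |(∑ x ∈ s, k x * cos (∑ j, (x j : ℝ) * (t * e j))) + 1 / 2 * (∑ x ∈ s, k x * (∑ j, (x j : ℝ) * e j) ^ 2) * t ^ 2|
      ≤ (∑ x ∈ s, |k x| * |∑ j, (x j : ℝ) * e j| ^ 4) / 6 * t ^ 4 := by
  rw [symbol_ray]
  exact abs_symbol_sub_marginal_le (fun x : Fin d → ℤ => ∑ j, (x j : ℝ) * e j) hW t

/-! ## §6 Toy: the lattice Laplacian -/

/-- The lattice Laplacian kernel on `{−1, 0, 1}` (`k(0) = −2`, `k(±1) = 1`) annihilates constants and has symbol `2cos t − 2`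
(`= −t² + t⁴∕12 − …`: no mass term, marginal coefficient `−½·Σx²k = −1`). [folklore] -/
theorem laplacian_symbol (t : ℝ) :
    (∑ x ∈ ({-1, 0, 1} : Finset ℤ), (if x = 0 then (-2 : ℝ) else 1) * cos (x * t)) = 2 * cos t - 2 := by
  rw [Finset.sum_insert (by decide), Finset.sum_insert (by decide), Finset.sum_singleton]
  simp only [show (-1 : ℤ) ≠ 0 by decide, show (1 : ℤ) ≠ 0 by decide, if_true, if_false]
  push_cast
  simp [cos_neg]
  ring

end

end Summit.QuantumFields.BalabanUV.T4Continuum.NE7b.LatticeKernelMoments
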